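import Summits.BirchSwinnertonDyer.BirchSwinnertonDyer.Theorems.Rank2ObservatoryPadicAtlasKitMin2
import Literature.NumberTheory.EllipticCurves.IwasawaLeadingTermProofs
import Literature.NumberTheory.EllipticCurves.IsogenyVariableChangeProofs
import Literature.NumberTheory.EllipticCurves.SelmerCorankIsogenyProofs
import HarnessLib

/-!
# BirchSwinnertonDyer / ShaPrimaryTransfer — crux `FiniteShaComponentTransfer` (stmt-BirchSwinnertonDyer-22356):
# THE ATLAS DOOR, route-independent (no `Theses` import)

Helper file of prover seat `bsd-line-spt-p1` g15 (`--supports stmt-22356 --as helper`). THEOREMS ONLY. The `p`-adic half of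
a cross-prime cell, packaged ONCE and free of the route file, so that cell files need not import another `Theorems` module that
imports `Theses.ShaPrimaryTransfer` (the theses-cone rule). For a record `C` of the rank-2 `p`-adic atlas kit
(`Rank2ObservatoryPadicAtlasKit`; Stein–Wuthrich Riemann-sum certificates of `ord_{T=0} L_p(E,T) = 2`), a model `E = C.e ⊗ ℚ`,
a kernel certificate `2 ≤ rank E(ℚ)` and a cell `c` of `C`, granting the printed inputs (`hPRS` Schneider / Perrin-Riou, `hkato`
Kato's divisibility, `hf` modularity by the named newform) and the symbol data (`hint`, `htab`):

* `atlasDoor_of_check`: **`rank E(ℚ) = 2 ∧ t_{c.p}(E) = 0 ∧ corank Sel_{p^∞}(E/ℚ) = 2`** (`AtlasCurve.padicRow` with the rank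
  hypothesis discharged and finiteness of `Ш[p^∞]` converted to `t_p = 0`); global minimality of the record is an instance
  hypothesis because the printed input `kato_divisibility` is stated for minimal models (on a literal record discharge it with
  `AtlasCurve.isGloballyMinimal (by decide +kernel)` / `isGloballyMinimal₂`);
* `shaCorank_eq_zero_of_variableChange`: transport of the other door `t_ℓ(X) = 0` from a normal form `X = v • E` to `E`.

A cell file then supplies only the other door (`t_2 = 0` by `2`-isogeny descent, `t_3 = 0` by `3`-isogeny descent, …) on any
model `X ≅ E` and transports it with `IsIsogenous.shaCorank_eq`. Usage on a literal record (the atlas modules `…PadicAtlasR2A*`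
carry no olean on the check farm): `(hC : C = ⟨…⟩) … subst hC; atlasDoor_of_check (by decide +kernel) hE hlow hc …` under
`set_option maxRecDepth 20000` / `maxHeartbeats 2000000`.

Nothing here proves T, O or BSD; the atlas door is CONDITIONAL on its printed inputs. No claim on BSD in rank ≥ 2.

## References

* W. Stein, C. Wuthrich, Math. Comp. 82 (2013), §3, Algorithm 11.1 / Prop. 11.2. [SteinWuthrich2013]
* K. Kato, Astérisque 295 (2004), Thm. 17.4. [Kato2004Asterisque]
* J. Balakrishnan, J. S. Müller, W. Stein, Math. Comp. 85 (2016), Thm. 1.7. [BalakrishnanMullerStein2015]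
* R. Greenberg, LNM 1716 (1999), §1 (pp. 54–57). [Greenberg1999LNM]
-/

-- D-0017: single-problem summit, so `Summit.BirchSwinnertonDyer.BirchSwinnertonDyer.…` repeats a namespace BY DESIGN.
set_option linter.dupNamespace false

noncomputable section

namespace Summit.BirchSwinnertonDyer.BirchSwinnertonDyer.Theorems.ShaPrimaryTransferCrossPrimeAtlasDoor

open scoped Classical
open scoped MatrixGroups ModularForm
open CongruenceSubgroup
open Summit.BirchSwinnertonDyer.BirchSwinnertonDyer.Rank2Observatory
open Literature.NumberTheory.EllipticCurves Literature.NumberTheory.EllipticCurves.ModularForms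
open WeierstrassCurve

/-- **The atlas door.** For an atlas record `C` with `C.check = true`, a model `E = C.e ⊗ ℚ` with `2 ≤ rank E(ℚ)`, a cell
`c ∈ C.cells`, global minimality of the record granted as an instance: granting `hPRS`, `hkato`, `hf`, `hint`, `htab`,
**`rank E(ℚ) = 2`, `t_{c.p}(E) = 0` and `corank Sel_{p^∞}(E/ℚ) = 2`**. [cite: SteinWuthrich2013, Algorithm 11.1 and Prop. 11.2]
[cite: Kato2004Asterisque, Thm. 17.4] [cite: BalakrishnanMullerStein2015, Thm. 1.7] [cite: Greenberg1999LNM, §1 (pp. 54–57)] -/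
theorem atlasDoor_of_check {C : AtlasCurve} (h : C.check = true) {E : WeierstrassCurve ℚ}
    (hE : C.e.baseChange ℚ = E) (hlow : 2 ≤ E.mordellWeilRank) {c : AtlasCell}
    (hc : c ∈ C.cells) [Fact c.p.Prime] [(C.e.baseChange ℚ).IsElliptic] [(C.e.baseChange ℚ).IsGloballyMinimal]
    (hPRS : Schneider1985_order_charGenerator) {N : ℕ} [NeZero N]
    {f : CuspForm (Gamma0 N) 2} (hf : IsNewformOf (C.e.baseChange ℚ) f)
    (hkato : ∀ (κ : ZpExtension ℚ c.p) (γ : Field.absoluteGaloisGroup ℚ),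
      kato_divisibility (C.e.baseChange ℚ) c.p (κ := κ) (γ := γ) (f := f))
    (D : ℚ) (hD : ‖(D : ℚ_[c.p])‖ = 1)
    (hint : ∀ x : ℚ, ‖(ratPlusSymbol f x : ℚ_[c.p])‖ ≤ 1)
    (htab : ∀ u : ℕ, u < c.p ^ (c.n + 1) → ¬ c.p ∣ u →
      ratPlusSymbol f ((u : ℚ) / (c.p : ℚ) ^ (c.n + 1)) = (c.tabHi.getD u 0 : ℚ) / D ∧
      ratPlusSymbol f ((u : ℚ) / (c.p : ℚ) ^ c.n) = (c.tabLo.getD (u % c.p ^ c.n) 0 : ℚ) / D) :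
    E.mordellWeilRank = 2 ∧ E.shaCorank c.p = 0 ∧ E.selmerCorank c.p = 2 := by
  subst hE
  have hlow' : 2 ≤ C.row.curve.mordellWeilRank := by rw [← AtlasCurve.baseChange_e]; exact hlow
  obtain ⟨hr, -, hfin, -, hsel⟩ := AtlasCurve.padicRow h hc hPRS hf hkato hlow' D hD hint htab
  exact ⟨by rw [AtlasCurve.baseChange_e]; exact hr, (finite_primaryComponent_sha_iff_shaCorank_eq_zero _ c.p).mp hfin, hsel⟩

/-- **Two doors on one curve from two models.** If `X ≅ E` by a change of variables (`v • E = X`) and `t_ℓ(X) = 0` (a descent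
door on the normal form `X`), then `t_ℓ(E) = 0`; with the atlas door this is the cell `t_ℓ(E) = 0 = t_p(E)`.
[cite: SilvermanAEC2009, III.3.1(b)] [cite: Greenberg1999LNM, §1 (pp. 54–57)] -/
theorem shaCorank_eq_zero_of_variableChange {E X : WeierstrassCurve ℚ} [E.IsElliptic] [X.IsElliptic]
    (v : VariableChange ℚ) (hv : v • E = X) (ℓ : ℕ) [Fact ℓ.Prime] (hX : X.shaCorank ℓ = 0) : E.shaCorank ℓ = 0 := by
  rw [(isIsogenous_of_smul_eq hv).shaCorank_eq ℓ]; exact hX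

end Summit.BirchSwinnertonDyer.BirchSwinnertonDyer.Theorems.ShaPrimaryTransferCrossPrimeAtlasDoor

end
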